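import Mathlib
import Literature.Computability.AlgebraicComplexity.GroupAlgebraTensor

/-!
# Wedderburn blocks of the image algebra are irreducible constituents

Route `MatrixMultiplication/GLnSeparatingDesigns`, crux `stmt-MatrixMultiplication-18361`
(`SeparationDegreeCost`), line `SketchIdeator1`; registered stub
`stub_exists_irreducible_finrank_eq_block`.

Let `ρ : G → GL(V)` be a finite-dimensional complex representation, `A = ρ(ℂ[G]) ⊆ End V` its image
algebra (`(Representation.asAlgebraHom ρ).range`) and `e : A ≃ₐ ∏ᵢ ℂ^{dᵢ×dᵢ}` (`BlockAlgebra ℂ d`)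
Wedderburn coordinates. Then every block size `dᵢ` is the dimension of an irreducible
subrepresentation of `ρ`.

Proof (matrix units, no semisimplicity hypothesis needed). Put `E_{ab} = e⁻¹(eᵢ ⊗ e_{ab}) ∈ A`
(`Pi.single i (Matrix.single a b 1)`). These satisfy `E_{ab} E_{b'c} = δ_{bb'} E_{ac}`, `E_{ab} ≠ 0`, and
`x E_{ab} = ∑_{a'} (e x)ᵢ_{a'a} E_{a'b}` for every `x ∈ A` (identities of `∏ᵢ ℂ^{dᵢ×dᵢ}` transported
by `e⁻¹`). Pick `v` with `E_{a₀a₀} v ≠ 0` and put `w_a = E_{a a₀} v`. Then `W = span{w_a}` is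
`A`-stable (hence `ρ`-stable, `ρ g ∈ A`), the `w_a` are linearly independent (apply `E_{a₀ a}`), so
`dim W = dᵢ`, and every nonzero `A`-stable subspace `U ⊆ W` contains some `u = ∑ cₐ wₐ` with
`c_a ≠ 0`, whence `E_{a₁ a} u = c_a w_{a₁} ∈ U` for all `a₁` and `U = W`; since `A` is spanned by the
`ρ g`, `ρ`-stable subspaces of `W` are `A`-stable, so `W` is irreducible.
-/

-- `Summit.MatrixMultiplication.MatrixMultiplication.…` is the tree's mandated summit-side namespace (Sub = Summit), flagged by `dupNamespace`.
set_option linter.dupNamespace false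

namespace Summit.MatrixMultiplication.MatrixMultiplication.Theorems

open scoped BigOperators
open Literature.Computability.AlgebraicComplexity

/-- Right multiplication by a matrix unit: `N · e_{ab} = ∑_{a'} N_{a'a} e_{a'b}`. [folklore] -/
private theorem matrix_mul_single_one {n : ℕ} (N : Matrix (Fin n) (Fin n) ℂ) (a b : Fin n) :
    N * Matrix.single a b 1 = ∑ a', N a' a • Matrix.single a' b (1 : ℂ) := by
  ext c c'
  rw [Matrix.sum_apply]
  simp only [Matrix.smul_apply, Matrix.single_apply, smul_eq_mul, mul_ite, mul_one, mul_zero]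
  by_cases h : c' = b
  · subst h
    rw [Matrix.mul_single_apply_same, mul_one]
    simp only [and_true]
    rw [Finset.sum_ite_eq']
    simp
  · rw [Matrix.mul_single_apply_of_ne _ _ _ _ _ h]
    symm
    refine Finset.sum_eq_zero fun a' _ => ?_
    rw [if_neg]
    exact fun hh => h hh.2.symm

variable {r : ℕ} (d : Fin r → ℕ) (i : Fin r)

/-- In `∏ᵢ ℂ^{dᵢ×dᵢ}`: `y · E^{(i)}_{ab} = ∑_{a'} (yᵢ)_{a'a} E^{(i)}_{a'b}`. [folklore] -/
private theorem block_mul_unit (y : BlockAlgebra ℂ d) (a b : Fin (d i)) :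
    y * Pi.single i (Matrix.single a b (1 : ℂ)) =
      ∑ a', y i a' a • (Pi.single i (Matrix.single a' b (1 : ℂ)) : BlockAlgebra ℂ d) := by
  funext j
  rw [Finset.sum_apply, Pi.mul_apply]
  rcases eq_or_ne j i with rfl | hj
  · simp only [Pi.smul_apply, Pi.single_eq_same]
    exact matrix_mul_single_one (N := y j) a b
  · simp [Pi.single_eq_of_ne hj]

/-- In `∏ᵢ ℂ^{dᵢ×dᵢ}`: `E^{(i)}_{ab} E^{(i)}_{b'c} = δ_{bb'} E^{(i)}_{ac}`. [folklore] -/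
private theorem unit_mul_unit (a b b' c : Fin (d i)) :
    (Pi.single i (Matrix.single a b (1 : ℂ)) : BlockAlgebra ℂ d) *
        Pi.single i (Matrix.single b' c (1 : ℂ)) =
      if b = b' then Pi.single i (Matrix.single a c (1 : ℂ)) else 0 := by
  rw [← Pi.single_mul]
  split_ifs with h
  · subst h
    rw [Matrix.single_mul_single_same, mul_one]
  · rw [Matrix.single_mul_single_of_ne _ _ _ _ h, Pi.single_zero]

/-- The matrix units of `∏ᵢ ℂ^{dᵢ×dᵢ}` are nonzero. [folklore] -/
private theorem unit_ne_zero (a b : Fin (d i)) :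
    (Pi.single i (Matrix.single a b (1 : ℂ)) : BlockAlgebra ℂ d) ≠ 0 := by
  intro h
  have h1 := congrFun (congrFun (congrFun h i) a) b
  simp at h1

/-- **Linear-algebra core.** For a subalgebra `A ⊆ End V` with Wedderburn coordinates
`e : A ≃ₐ ∏ᵢ ℂ^{dᵢ×dᵢ}` and a block `i` with `dᵢ ≠ 0`, there is an `A`-stable subspace `W ⊆ V` of
dimension `dᵢ` which is `A`-simple: every nonzero `A`-stable subspace of `W` is `W`. [folklore] -/
private theorem exists_stable_simple_submodule {V : Type*} [AddCommGroup V] [Module ℂ V]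
    (A : Subalgebra ℂ (Module.End ℂ V)) (e : A ≃ₐ[ℂ] BlockAlgebra ℂ d) [NeZero (d i)] :
    ∃ W : Submodule ℂ V,
      (∀ x : A, ∀ y ∈ W, (x : Module.End ℂ V) y ∈ W) ∧
      Module.finrank ℂ W = d i ∧ W ≠ ⊥ ∧
      ∀ U : Submodule ℂ V, U ≤ W → (∀ x : A, ∀ y ∈ U, (x : Module.End ℂ V) y ∈ U) →
        U ≠ ⊥ → U = W := by
  -- the matrix units of block `i`, inside `A`
  obtain ⟨E, hE⟩ : ∃ E : Fin (d i) → Fin (d i) → A,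
      ∀ a b, E a b = e.symm (Pi.single i (Matrix.single a b (1 : ℂ))) := ⟨_, fun _ _ => rfl⟩
  have hEe : ∀ a b, e (E a b) = Pi.single i (Matrix.single a b (1 : ℂ)) := fun a b => by
    rw [hE, AlgEquiv.apply_symm_apply]
  have hmulE : ∀ (x : A) (a b : Fin (d i)), x * E a b = ∑ a', e x i a' a • E a' b := by
    intro x a b
    apply e.injective
    rw [map_mul, hEe, block_mul_unit, map_sum]
    simp only [map_smul, hEe]
  have hEE : ∀ a b b' c : Fin (d i), E a b * E b' c = if b = b' then E a c else 0 := by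
    intro a b b' c
    apply e.injective
    rw [map_mul, hEe, hEe, unit_mul_unit]
    split_ifs
    · rw [hEe]
    · rw [map_zero]
  have hEne : ∀ a b, (E a b : Module.End ℂ V) ≠ 0 := by
    intro a b h
    rw [Subalgebra.coe_eq_zero] at h
    apply unit_ne_zero d i a b
    rw [← hEe a b, h, map_zero]
  -- applied versions
  have hmulEv : ∀ (x : A) (a b : Fin (d i)) (y : V),
      (x : Module.End ℂ V) ((E a b : Module.End ℂ V) y) =
        ∑ a', e x i a' a • (E a' b : Module.End ℂ V) y := by
    intro x a b y
    have h1 := congrArg (fun z : A => (z : Module.End ℂ V) y) (hmulE x a b)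
    simpa only [Subalgebra.coe_mul, Module.End.mul_apply, map_sum, map_smul, Subalgebra.coe_val,
      AddSubmonoidClass.coe_finsetSum, Subalgebra.coe_smul, LinearMap.sum_apply,
      LinearMap.smul_apply] using h1
  have hEEv : ∀ (a b b' c : Fin (d i)) (y : V),
      (E a b : Module.End ℂ V) ((E b' c : Module.End ℂ V) y) =
        if b = b' then (E a c : Module.End ℂ V) y else 0 := by
    intro a b b' c y
    rw [← Module.End.mul_apply, ← Subalgebra.coe_mul, hEE]
    split_ifs
    · rfl
    · rfl
  -- the cyclic vectors
  obtain ⟨v, hv⟩ : ∃ v : V, (E 0 0 : Module.End ℂ V) v ≠ 0 := by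
    by_contra! h
    exact hEne 0 0 (LinearMap.ext h)
  obtain ⟨w, hw⟩ : ∃ w : Fin (d i) → V, ∀ a, w a = (E a 0 : Module.End ℂ V) v :=
    ⟨_, fun _ => rfl⟩
  have hw0 : w 0 ≠ 0 := by
    rw [hw]
    exact hv
  have hxw : ∀ (x : A) (a : Fin (d i)), (x : Module.End ℂ V) (w a) = ∑ a', e x i a' a • w a' := by
    intro x a
    simp only [hw]
    exact hmulEv x a 0 v
  have hEw : ∀ a b a' : Fin (d i), (E a b : Module.End ℂ V) (w a') = if b = a' then w a else 0 := by
    intro a b a'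
    rw [hw, hw, hEEv]
  -- linear independence
  have hli : LinearIndependent ℂ w := by
    rw [Fintype.linearIndependent_iff]
    intro c hc a
    have h1 := congrArg (E 0 a : Module.End ℂ V) hc
    rw [map_sum, map_zero] at h1
    simp only [map_smul, hEw, smul_ite, smul_zero, Finset.sum_ite_eq, Finset.mem_univ,
      if_true] at h1
    exact (smul_eq_zero.mp h1).resolve_right hw0
  refine ⟨Submodule.span ℂ (Set.range w), ?_, ?_, ?_, ?_⟩
  · -- `A`-stability
    intro x y hy
    have h1 : Submodule.span ℂ (Set.range w) ≤
        (Submodule.span ℂ (Set.range w)).comap (x : Module.End ℂ V) := by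
      rw [Submodule.span_le]
      rintro _ ⟨a, rfl⟩
      simp only [SetLike.mem_coe, Submodule.mem_comap]
      rw [hxw]
      exact Submodule.sum_mem _ fun a' _ =>
        Submodule.smul_mem _ _ (Submodule.subset_span ⟨a', rfl⟩)
    exact h1 hy
  · rw [finrank_span_eq_card hli, Fintype.card_fin]
  · intro h
    apply hw0
    have h1 : w 0 ∈ Submodule.span ℂ (Set.range w) := Submodule.subset_span ⟨0, rfl⟩
    rw [h, Submodule.mem_bot] at h1
    exact h1
  · -- simplicity
    intro U hUle hUstab hUne
    refine le_antisymm hUle ?_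
    obtain ⟨u, huU, hu0⟩ := Submodule.exists_mem_ne_zero_of_ne_bot hUne
    obtain ⟨c, hc⟩ := (Submodule.mem_span_range_iff_exists_fun ℂ).mp (hUle huU)
    obtain ⟨a, ha⟩ : ∃ a, c a ≠ 0 := by
      by_contra! h
      apply hu0
      rw [← hc]
      exact Finset.sum_eq_zero fun a _ => by simp [h a]
    rw [Submodule.span_le]
    rintro _ ⟨a₁, rfl⟩
    have h1 : (E a₁ a : Module.End ℂ V) u ∈ U := hUstab (E a₁ a) u huU
    rw [← hc, map_sum] at h1
    simp only [map_smul, hEw, smul_ite, smul_zero, Finset.sum_ite_eq, Finset.mem_univ,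
      if_true] at h1
    exact (Submodule.smul_mem_iff U ha).mp h1

/-- **Stub S2 (blocks are irreducible constituents).** Given Wedderburn coordinates
`e : ρ(ℂ[G]) ≃ₐ ∏ᵢ ℂ^{dᵢ×dᵢ}` (`BlockAlgebra ℂ d`) of the image algebra of a finite-dimensional
representation, every block size `dᵢ` is the dimension of an irreducible subrepresentation of `ρ`:
with the matrix units `E^{(i)}_{ab} = e⁻¹(eᵢ ⊗ e_{ab})` and `v`, `a₀` with `E_{a₀a₀} v ≠ 0`, the span
`W` of the `E_{a a₀} v` is `A`-stable of dimension `dᵢ` and every nonzero vector of `W` generates it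
(`exists_stable_simple_submodule`); `ρ g ∈ A` makes `W` a subrepresentation and `A = span ρ(G)` makes
`ρ`-stable subspaces of `W` `A`-stable, so `W` is irreducible. [folklore] -/
theorem stub_exists_irreducible_finrank_eq_block {G V : Type*} [Group G] [AddCommGroup V]
    [Module ℂ V] [FiniteDimensional ℂ V] (ρ : Representation ℂ G V) {r : ℕ} (d : Fin r → ℕ)
    [∀ i, NeZero (d i)] (e : (Representation.asAlgebraHom ρ).range ≃ₐ[ℂ] BlockAlgebra ℂ d)
    (i : Fin r) :
    ∃ W : Subrepresentation ρ, W.toRepresentation.IsIrreducible ∧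
      Module.finrank ℂ W.toSubmodule = d i := by
  obtain ⟨W₀, hstab, hfin, hne, hsimp⟩ :=
    exists_stable_simple_submodule d i (Representation.asAlgebraHom ρ).range e
  have hmem : ∀ g : G, ρ g ∈ (Representation.asAlgebraHom ρ).range := fun g =>
    (AlgHom.mem_range _).mpr ⟨MonoidAlgebra.single g 1, Representation.asAlgebraHom_single_one ρ g⟩
  obtain ⟨W, hW⟩ : ∃ W : Subrepresentation ρ, W.toSubmodule = W₀ :=
    ⟨⟨W₀, fun g y hy => hstab ⟨ρ g, hmem g⟩ y hy⟩, rfl⟩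
  subst hW
  refine ⟨W, ?_, hfin⟩
  -- `ρ`-stable subspaces of `W` are `A`-stable (as subspaces of `V`)
  have hU : ∀ (U : Subrepresentation W.toRepresentation) (x : (Representation.asAlgebraHom ρ).range)
      (y : V), y ∈ U.toSubmodule.map W.toSubmodule.subtype →
        (x : Module.End ℂ V) y ∈ U.toSubmodule.map W.toSubmodule.subtype := by
    intro U x y hy
    obtain ⟨f, hf⟩ := (AlgHom.mem_range _).mp x.2
    rw [← hf]
    clear hf
    induction f using MonoidAlgebra.induction_linear with
    | zero =>
      rw [map_zero, LinearMap.zero_apply]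
      exact Submodule.zero_mem _
    | add f₁ f₂ h₁ h₂ =>
      rw [map_add, LinearMap.add_apply]
      exact Submodule.add_mem _ h₁ h₂
    | single g c =>
      rw [Representation.asAlgebraHom_single, LinearMap.smul_apply]
      refine Submodule.smul_mem _ _ ?_
      obtain ⟨u, hu, rfl⟩ := Submodule.mem_map.mp hy
      exact Submodule.mem_map.mpr ⟨W.toRepresentation g u, U.apply_mem_toSubmodule g hu, rfl⟩
  have hbot : (⊥ : Subrepresentation W.toRepresentation).toSubmodule = ⊥ := rfl
  have htop : (⊤ : Subrepresentation W.toRepresentation).toSubmodule = ⊤ := rfl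
  have hinj : Function.Injective (Submodule.map W.toSubmodule.subtype) :=
    Submodule.map_injective_of_injective W.toSubmodule.injective_subtype
  haveI : Nontrivial (Subrepresentation W.toRepresentation) := ⟨⟨⊥, ⊤, fun h => hne (by
    have h' := congrArg
      (fun U : Subrepresentation W.toRepresentation => U.toSubmodule.map W.toSubmodule.subtype) h
    simp only [hbot, htop, Submodule.map_bot, Submodule.map_subtype_top] at h'
    exact h'.symm)⟩⟩
  refine ⟨fun U => ?_⟩
  by_cases hUb : U.toSubmodule.map W.toSubmodule.subtype = ⊥
  · left
    apply Subrepresentation.toSubmodule_injective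
    rw [hbot]
    exact hinj (hUb.trans (Submodule.map_bot _).symm)
  · right
    apply Subrepresentation.toSubmodule_injective
    rw [htop]
    exact hinj ((hsimp _ (Submodule.map_subtype_le _ _) (hU U) hUb).trans
      (Submodule.map_subtype_top W.toSubmodule).symm)

end Summit.MatrixMultiplication.MatrixMultiplication.Theorems
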